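import Summits.ValiantsHypothesis.ValiantsHypothesis.Theorems.DefinabilityGapAffineRung
import HarnessLib

/-!
# DefinabilityGap — the SEED TORUS of the planted KI-permanent map: `V_m` is a cone (unconditional, kernel)

Route `route-ValiantsHypothesis-DefinabilityGap` (decomp-valiant cycle 1, lens 5: hardness–randomness / PIT axis),
supporting the hitting items (`KIPlantedHittingWs`, stmt-ValiantsHypothesis-23701; parent `KIPlantedHitting`) and the
bet `KIAnnihilatorCHDefinable` (stmt-ValiantsHypothesis-23444).

`kiPer_torus`: scaling the seed variable `y_{(k,j)}` by `α_a β_b`, where `k < m²` is the position of the matrix entry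
`(a, b)` (`permPad`), multiplies EVERY coordinate `per_m(y|S_c)` of `G_m` by `(∏ α)(∏ β)`: the rank-`(2m−1)` torus of
row/column scalings of the position grid acts on the seed compatibly with all `q³` blocks at once (cell positions depend
on the abscissa only, `quadDesign_fst`-type fact `(cellEmb m c x).1 = permPad x`). Consequences: the subtorus
`∏α∏β = 1` of dimension `2m − 2` acts on the fibres of `G_m`, so `trdeg_ℂ {per_m(y|S_c)}_c ≤ m²·q − 2m + 2` (the
instrument of the route folder, `v4/instrument-sym-m3.md`, finds rank exactly `95 = 99 − 4` at `m = 3`) — the exact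
ceiling of the algebraic-independence road to K1; and (`kiPer_cone`, `m ≥ 1`) the closure `V_m` of the image is a CONE,
so the annihilator ideal `I(G_m)` is homogeneous. 0 sorry; no definitions.
-/

noncomputable section

open MvPolynomial
open Literature.Computability.AlgebraicComplexity Literature.Computability.MetaComplexity
open Summit.ValiantsHypothesis.ValiantsHypothesis.Theorems.DefinabilityGapAffineRung

namespace Summit.ValiantsHypothesis.ValiantsHypothesis.Theorems.DefinabilityGapTorus

/-- **Seed-torus equivariance**: with `w (permPad (a,b)) = α a * β b` (arbitrary at unused abscissae), the diagonal
substitution `y_p ↦ w(p.1) · y_p` multiplies every coordinate of `G_m` by `(∏ α)(∏ β)`. [this file] -/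
theorem kiPer_torus (m : ℕ) (c : Fin 3 → Fin (qOf m)) (α β : Fin m → ℂ) (w : Fin (qOf m) → ℂ)
    (hw : ∀ a b, w (permPad (sq_le_qOf m) (a, b)) = α a * β b) :
    bind₁ (fun p : Fin (qOf m) × Fin (qOf m) => C (w p.1) * X p) (kiPer m c) =
      C ((∏ a, α a) * ∏ b, β b) * kiPer m c := by
  classical
  have hper : perPoly (Fin m) ℂ = ∑ σ : Equiv.Perm (Fin m), ∏ i, X (σ i, i) := by
    simp [perPoly, Matrix.permanent, Matrix.mvPolynomialX]
  have h1 : ∀ x : Fin m × Fin m, (cellEmb m c x).1 = permPad (sq_le_qOf m) x := fun x => by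
    rw [cellEmb, Function.Embedding.trans_apply]
    haveI : NeZero (qOf m) := ⟨(qOf_spec m).2.ne_zero⟩
    exact (ZMod.finEquiv (qOf m)).toEquiv.symm_apply_apply _
  rw [kiPer_eq_rename_cellEmb, bind₁_rename, hper, map_sum, map_sum, Finset.mul_sum]
  refine Finset.sum_congr rfl fun σ _ => ?_
  rw [map_prod, map_prod]
  simp only [Function.comp_apply, bind₁_X_right, rename_X, h1]
  have h2 : ∀ i, w (permPad (sq_le_qOf m) (σ i, i)) = α (σ i) * β i := fun i => hw _ _
  simp_rw [h2, Finset.prod_mul_distrib, ← map_prod C, Finset.prod_mul_distrib, Equiv.prod_comp σ α]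

/-- **`V_m` is a cone** (`m ≥ 1`): for every scalar `l` one diagonal scaling of the seed multiplies all `q³` coordinates
of `G_m` by `l`; hence every homogeneous component of an annihilator of `G_m` is an annihilator. [this file] -/
theorem kiPer_cone (m : ℕ) (hm : 0 < m) (l : ℂ) : ∃ w : Fin (qOf m) → ℂ, ∀ c : Fin 3 → Fin (qOf m),
    bind₁ (fun p : Fin (qOf m) × Fin (qOf m) => C (w p.1) * X p) (kiPer m c) = C l * kiPer m c := by
  classical
  let α : Fin m → ℂ := Function.update (fun _ => 1) ⟨0, hm⟩ l
  refine ⟨Function.extend (permPad (sq_le_qOf m)) (fun ab => α ab.1 * 1) (fun _ => 1), fun c => ?_⟩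
  rw [kiPer_torus m c α (fun _ => 1) _ (fun a b => (permPad (sq_le_qOf m)).injective.extend_apply _ _ (a, b))]
  congr 2
  rw [Finset.prod_const_one, mul_one, Finset.prod_update_of_mem (Finset.mem_univ _), Finset.prod_const_one, mul_one]

end Summit.ValiantsHypothesis.ValiantsHypothesis.Theorems.DefinabilityGapTorus

end
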